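import Summits.ValiantsHypothesis.ValiantsHypothesis.Theorems.RefutationDegreeDefs
import Summits.ValiantsHypothesis.ValiantsHypothesis.Theorems.RefutationDegreeNsToSos

/-!
# Crux `RefutationDegree.BeyondHessianSos` (stmt-ValiantsHypothesis-5643), line `Sketch` —
# the route's dependency edge `BeyondHessianNs ⇒ BeyondHessianSos`

Support file (`--supports stmt-ValiantsHypothesis-5643`).  The route files the crux
`BeyondHessianSos` (Hermitian-SOS refutations of Rep(n, ⌊n²/2⌋+1) of degree `n^c`, eventually)
with `[deps: BeyondHessianNs]` and the remark "implied by BeyondHessianNs": a Nullstellensatz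
refutation of degree `d` is a Hermitian-SOS refutation of degree `d` (support item `NsToSos`,
LANDED as `nsToSos_proof`).  This file records that implication as a theorem between the two
route decls (`BeyondHessianSos_of_BeyondHessianNs`), and its pointwise form
(`hasSosRef_of_hasNsRef`), so that a proof of item 5641 closes item 5643 in one line (and,
contrapositively, the kill criterion "RefutationBarrier ⇒ ¬BeyondHessianNs" can be read off).
The lead skeleton of the line does NOT route through this edge (that would make the line
vacuous); it is bookkeeping for the route.
-/

set_option linter.dupNamespace false

noncomputable section

namespace Summit.ValiantsHypothesis.ValiantsHypothesis.Theorems.RefutationDegreeBeyondHessianSos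

open Summit.ValiantsHypothesis.ValiantsHypothesis.Theses.RefutationDegree
open Summit.ValiantsHypothesis.ValiantsHypothesis.Theorems.RefutationDegree

/-- Pointwise form of the landed support item `NsToSos`: a Nullstellensatz refutation of
Rep(n,m) of degree `D` is a Hermitian-SOS refutation of degree `D`. -/
theorem hasSosRef_of_hasNsRef {n m D : ℕ} (h : HasNsRef n m D) : HasSosRef n m D :=
  nsToSos_iff.mp nsToSos_proof n m D h

/-- **The dependency edge of the route: `BeyondHessianNs ⇒ BeyondHessianSos`.**  If for all large
`n` the system Rep(n, ⌊n²/2⌋+1) has a Nullstellensatz refutation with products of degree `≤ n^c`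
(item 5641), then it has Hermitian-SOS refutations of the same degree (item 5643), by the landed
`NsToSos`. -/
theorem BeyondHessianSos_of_BeyondHessianNs (h : BeyondHessianNs) : BeyondHessianSos := by
  rw [beyondHessianSos_iff]
  rw [beyondHessianNs_iff] at h
  obtain ⟨c, n₀, h⟩ := h
  exact ⟨c, n₀, fun n hn => hasSosRef_of_hasNsRef (h n hn)⟩

end Summit.ValiantsHypothesis.ValiantsHypothesis.Theorems.RefutationDegreeBeyondHessianSos

end
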